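import Summits.BirchSwinnertonDyer.BirchSwinnertonDyer.Theorems.SignedLowerHalvesSmallImageLowerHalfBothSignsRttD2J2DeltaWrongWay
import Literature.NumberTheory.GaloisRepresentations.ContinuousCohomologyConnectingNaturality
import Literature.NumberTheory.GaloisRepresentations.ContinuousShapiroOpenCoinducedDescent
import HarnessLib

/-!
# Route `SignedLowerHalves`, crux L `SmallImageLowerHalfBothSigns` (stmt-BirchSwinnertonDyer-23599), line `rtt_w3` v15 — E2, junction row J2,
# research half «δ₁», brick (δ-c): THE FINITE-LEVEL CONNECTING MAP `d = H²(r) ∘ δ₁ : H¹(G, Maps(G ⧸ U', M)) → H²(G, Maps(G ⧸ V, M))`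
# IN THE PERMUTATION MODEL, and its seven laws

INPUTS hand `bsd-inputs-honda-p1` g24 under LEAD `cruxlead-stmt-BirchSwinnertonDyer-23599` g11 (v15 SPEC, stub B `stub_charRoadJunction_ns`, row J2; J2 socket p786107).
Generic continuous cohomology (no number theory). With bricks (δ-b1) (the short exact sequence `0 → ker Σ' → Maps(G ⧸ V', M) —Σ'→ Maps(G ⧸ U', M) → 0`, tree
`IsSES`, hence the tree's connecting map `δ₁ : H¹(G, Maps(G ⧸ U', M)) → H²(G, ker Σ')`) and (δ-b2) (the wrong-way map `r : ker Σ' → Maps(G ⧸ V, M)`) the finite-level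
specialisation connecting map in the permutation model is ★ `dPerm := H²(r) ∘ δ₁`. Laws (all from the tree's `δ₁_map_one`, `exists_map_one_eq_of_δ₁_eq_zero`,
`map_two_δ₁`, `cohomologyMap_δ₁` and the module identities of (δ-a)/(δ-b2), assembled with `cohomologyMap_comp_apply_of_eq/_of_sum`):
* (c1) `dPerm_map_one` — `d ∘ H¹(Σ') = 0`; (c2) `rTransHom_dPerm` — `H²(R_c) ∘ d = d` (the image is `R_c`-invariant: `(R_c − 1) ∘ r = Σ_{V'→V} ∘ ι` and `H²(ι) ∘ δ₁ = 0`);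
* (c3) `coindFinSum_dPerm` — `H²(Σ_{V→V₀}) ∘ d_V = d_{V₀}`; (c4) `dPerm_coindFinSum` — `d_{(U',V')} ∘ H¹(Σ_{U''→U'}) = d_{(U'',V'')}` (naturality of `δ₁` + transitivity of `r`);
* (c5) `coindFinMap_dPerm` — coefficient change; (c6) `rTransHom_dPerm_conj` — `H²(R_γ) ∘ d = d ∘ H¹(R_γ)` when `γ̄ c̄ = c̄ γ̄`;
* (c7) `exists_coindFinSum_eq_of_dPerm_eq_zero` — EXACTNESS TRANSFER: if `d_{(U_m,V_m)→V_n} x = 0` then `H¹(Σ_{U_m→U_n}) x ∈ range H¹(Σ_{V_n→U_n})` (`ker Σ_m → ker Σ_n` factors as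
  `(R_c − 1)' ∘ r`, so `δ_n (H¹(Σ^U) x) = H²((R_c − 1)') (H²(r) (δ_m x)) = 0`).
Under Shapiro (brick (δ-d)) these are the laws of `d_{n,k} : H¹(K^{(1)}_m, X_k) → H²(K̃_n, X_k)[conj γ₂ − 1]` against `cor`, `red`, `conj`, `H(c ⊗ id)`.
DEFINITIONS WITH BODIES + THEOREMS (`--supports stmt-BirchSwinnertonDyer-23599` helper); no named fact, no `sorry`, no instance; crux L, crux M, E2 and BSD remain OPEN
and are proved for NO curve by any of this.
References: [SerreGaloisCohomology1997] I §2.2–§2.5; [NeukirchSchmidtWingberg2008] (1.3.2)–(1.3.3), I §5–§6; [PerrinRiou1994Invent] §1.3; [SerreLocalFields1979] VII §5–§7.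
-/

set_option autoImplicit false
-- the Theorems namespace of this sub repeats the summit name by design (D-0017 nested layout)
set_option linter.dupNamespace false

noncomputable section

open CategoryTheory
open scoped Classical

universe u

namespace Summit.BirchSwinnertonDyer.BirchSwinnertonDyer.Theorems.SmallImageRttD2J2Delta

open Literature.NumberTheory.GaloisRepresentations

variable {G : Type u} [Group G] [TopologicalSpace G] [IsTopologicalGroup G] [CompactSpace G] [LocallyCompactSpace G]
variable {M : Type u} [AddCommGroup M] [TopologicalSpace M] [DiscreteTopology M] (ρ : ContinuousRep G ℤ M)

/-! ## §1 `R_c − 1` with codomain `ker Σ`, and the factorisation `ker Σ' → ker Σ = (R_c − 1)' ∘ r` -/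

section ToKer

variable {U V : Subgroup G} (h : V ≤ U) (hV : IsOpen (V : Set G)) [V.Normal] (c : G) [Fintype (G ⧸ V)]

/-- **`(R_c − 1)' : Maps(G ⧸ V, M) ⟶ ker Σ_{V→U}`** for `c ∈ U` (`Σ ∘ (R_c − 1) = 0`, brick (δ-a)). [cite: SerreLocalFields1979, VII §5] -/
def rTransSubToKer (hc : c ∈ U) : coindFin.{0, u} ρ.toTopRep V ⟶ (kerRep ρ h hV).toTopRep :=
  TopRep.ofHom
    { toLinearMap := LinearMap.codRestrict (sumKer ρ h) (rTransSub ρ c)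
        (fun φ => (mem_sumKer ρ h).2 (coindFinSum_rTransHom_sub_of_mem ρ.toTopRep h hc φ))
      cont := continuous_of_discreteTopology
      isIntertwining' := fun g => by
        refine ContinuousLinearMap.ext fun φ => Subtype.ext ?_
        change rTransSub ρ c ((coindFin.{0, u} ρ.toTopRep V).ρ g φ) = (coindFin.{0, u} ρ.toTopRep V).ρ g (rTransSub ρ c φ)
        rw [rTransSub_apply, rTransSub_apply, map_sub, TopRep.hom_comm_apply] }

omit [LocallyCompactSpace G] in
/-- `(R_c − 1)'` on elements. [cite: SerreLocalFields1979, VII §5] -/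
@[simp] theorem rTransSubToKer_apply_coe (hc : c ∈ U) (φ : coindFin.{0, u} ρ.toTopRep V) :
    ((rTransSubToKer ρ h hV c hc).hom φ : G ⧸ V → M) = rTransSub ρ c φ := rfl

end ToKer

/-! ## §2 The connecting map `dPerm = H²(r) ∘ δ₁` -/

section DPerm

variable {U' V' V : Subgroup G} (h' : V' ≤ U') (hVV : V' ≤ V) [V'.Normal] (c : G) [Fintype (G ⧸ V')]
  (hU' : IsOpen (U' : Set G)) (hV' : IsOpen (V' : Set G)) [Fintype (G ⧸ U')] [Finite M] [Fintype (G ⧸ (V ⊓ U'))] (hc : c ∈ U')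
  (hgen : ∀ y y' : G ⧸ V', Subgroup.quotientMapOfLE h' y = Subgroup.quotientMapOfLE h' y' → ∃ j : ℕ, y' = y * (c : G ⧸ V') ^ j)
  (hidx : ∀ x : M, (V'.subgroupOf (V ⊓ U')).index • x = 0)

/-- ★ **The finite-level specialisation connecting map in the permutation model**, `d = H²(r) ∘ δ₁ : H¹(G, Maps(G ⧸ U', M)) → H²(G, Maps(G ⧸ V, M))`.
[cite: SerreGaloisCohomology1997, I §2.2–§2.3] [cite: PerrinRiou1994Invent, §1.3] -/
def dPerm : continuousCohomology 1 (coindFin.{0, u} ρ.toTopRep U') →+ continuousCohomology 2 (coindFin.{0, u} ρ.toTopRep V) :=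
  (cohomologyMap (rHom ρ h' hVV c hV' hc hgen hidx) 2).hom.toLinearMap.toAddMonoidHom.comp
    ((isSES_kerIncl_coindFinSum ρ h' hV' hU').δ₁ :
      continuousCohomology 1 (coindFin.{0, u} ρ.toTopRep U') →ₗ[ℤ] continuousCohomology 2 (kerRep ρ h' hV').toTopRep).toAddMonoidHom

/-- Unfolding `dPerm`. [cite: SerreGaloisCohomology1997, I §2.2–§2.3] -/
theorem dPerm_apply (x : continuousCohomology 1 (coindFin.{0, u} ρ.toTopRep U')) :
    dPerm ρ h' hVV c hU' hV' hc hgen hidx x =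
      cohomologyMap (rHom ρ h' hVV c hV' hc hgen hidx) 2 ((isSES_kerIncl_coindFinSum ρ h' hV' hU').δ₁ x) := rfl

/-- (c1) **`d ∘ H¹(Σ') = 0`** (exactness at `H¹(Maps(G ⧸ U', M))`: `δ₁ ∘ H¹(Σ') = 0`). [cite: SerreGaloisCohomology1997, I §2.2] [cite: NeukirchSchmidtWingberg2008, (1.3.2)] -/
theorem dPerm_map_one (w : continuousCohomology 1 (coindFin.{0, u} ρ.toTopRep V')) :
    dPerm ρ h' hVV c hU' hV' hc hgen hidx (cohomologyMap (coindFinSum ρ.toTopRep h') 1 w) = 0 := by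
  have h0 := (isSES_kerIncl_coindFinSum ρ h' hV' hU').δ₁_map_one w
  exact (congrArg (cohomologyMap (rHom ρ h' hVV c hV' hc hgen hidx) 2) h0).trans (map_zero _)

/-- (c2) **The image of `d` is `R_c`-invariant**: `H²(R_c) (d x) = d x`, because `R_c ∘ r = r + Σ_{V'→V} ∘ ι` on `ker Σ'` (brick (δ-b2)) and `H²(ι) ∘ δ₁ = 0` (exactness at
`H²(ker Σ')`). In the tower: `d_{n,k}` lands in `H²(K̃_n, X_k)[conj γ₂ − 1]`. [cite: SerreGaloisCohomology1997, I §2.2–§2.3] [cite: PerrinRiou1994Invent, §1.3] -/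
theorem rTransHom_dPerm [V.Normal] (x : continuousCohomology 1 (coindFin.{0, u} ρ.toTopRep U')) :
    cohomologyMap (rTransHom ρ.toTopRep V (c : G ⧸ V)) 2 (dPerm ρ h' hVV c hU' hV' hc hgen hidx x) = dPerm ρ h' hVV c hU' hV' hc hgen hidx x := by
  rw [dPerm_apply]
  set z := (isSES_kerIncl_coindFinSum ρ h' hV' hU').δ₁ x with hz
  have hsum := cohomologyMap_comp_apply_of_sum (rHom ρ h' hVV c hV' hc hgen hidx) (rTransHom ρ.toTopRep V (c : G ⧸ V)) (Finset.univ : Finset Bool)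
    (fun b => if b then rHom ρ h' hVV c hV' hc hgen hidx else kerIncl ρ h' hV' ≫ coindFinSum ρ.toTopRep hVV) (fun ψ => by
      rw [Fintype.sum_bool, if_pos rfl, if_neg Bool.false_ne_true]
      have h1 := rTransHom_rHom_sub ρ h' hVV c hV' hc hgen hidx ψ
      rw [sub_eq_iff_eq_add] at h1
      rw [h1, add_comm]
      rfl) 2 z
  rw [hsum, Fintype.sum_bool, if_pos rfl, if_neg Bool.false_ne_true]
  have h2 : cohomologyMap (kerIncl ρ h' hV' ≫ coindFinSum ρ.toTopRep hVV) 2 z = 0 := by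
    have h3 := (isSES_kerIncl_coindFinSum ρ h' hV' hU').map_two_δ₁ x
    have h4 := cohomologyMap_comp_apply_of_eq (kerIncl ρ h' hV') (coindFinSum ρ.toTopRep hVV) (kerIncl ρ h' hV' ≫ coindFinSum ρ.toTopRep hVV)
      (fun _ => rfl) 2 z
    exact h4.symm.trans ((congrArg (cohomologyMap (coindFinSum ρ.toTopRep hVV) 2) h3).trans (map_zero _))
  rw [h2, add_zero]

end DPerm

/-! ## §3 Transitivity in the target and in the source, coefficient change, conjugation -/

section Target

variable {U' V' V V₀ : Subgroup G} (h' : V' ≤ U') (hVV : V' ≤ V) (hV₀ : V ≤ V₀) [V'.Normal] (c : G)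
  [Fintype (G ⧸ V')] [Fintype (G ⧸ V)] (hU' : IsOpen (U' : Set G)) (hV' : IsOpen (V' : Set G)) [Fintype (G ⧸ U')] [Finite M]
  [Fintype (G ⧸ (V ⊓ U'))] [Fintype (G ⧸ (V₀ ⊓ U'))] (hc : c ∈ U')
  (hgen : ∀ y y' : G ⧸ V', Subgroup.quotientMapOfLE h' y = Subgroup.quotientMapOfLE h' y' → ∃ j : ℕ, y' = y * (c : G ⧸ V') ^ j)
  (hidx : ∀ x : M, (V'.subgroupOf (V ⊓ U')).index • x = 0) (hidx₀ : ∀ x : M, (V'.subgroupOf (V₀ ⊓ U')).index • x = 0)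

/-- (c3) **`H²(Σ_{V→V₀}) (d_V x) = d_{V₀} x`** (brick (δ-b2) `coindFinSum_rHom`). [cite: NeukirchSchmidtWingberg2008, I §5 Prop. (1.5.3)] -/
theorem coindFinSum_dPerm (x : continuousCohomology 1 (coindFin.{0, u} ρ.toTopRep U')) :
    cohomologyMap (coindFinSum ρ.toTopRep hV₀) 2 (dPerm ρ h' hVV c hU' hV' hc hgen hidx x) = dPerm ρ h' (hVV.trans hV₀) c hU' hV' hc hgen hidx₀ x := by
  rw [dPerm_apply, dPerm_apply]
  exact cohomologyMap_comp_apply_of_eq _ _ _ (coindFinSum_rHom ρ h' hVV hV₀ c hV' hc hgen hidx hidx₀) 2 _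

end Target

section Source

variable {U'' V'' U' V' V : Subgroup G} (h'' : V'' ≤ U'') (h' : V' ≤ U') (hVV' : V'' ≤ V') (hUU' : U'' ≤ U') (hVV : V' ≤ V)
  [V''.Normal] [V'.Normal] (c : G) [Fintype (G ⧸ V'')] [Fintype (G ⧸ V')] (hU'' : IsOpen (U'' : Set G)) (hU' : IsOpen (U' : Set G))
  (hV'' : IsOpen (V'' : Set G)) (hV' : IsOpen (V' : Set G)) [Fintype (G ⧸ U'')] [Fintype (G ⧸ U')] [Finite M]
  [Fintype (G ⧸ (V ⊓ U'))] [Fintype (G ⧸ (V ⊓ U''))] (hc' : c ∈ U') (hc'' : c ∈ U'')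
  (hgen' : ∀ y y' : G ⧸ V', Subgroup.quotientMapOfLE h' y = Subgroup.quotientMapOfLE h' y' → ∃ j : ℕ, y' = y * (c : G ⧸ V') ^ j)
  (hgen'' : ∀ y y' : G ⧸ V'', Subgroup.quotientMapOfLE h'' y = Subgroup.quotientMapOfLE h'' y' → ∃ j : ℕ, y' = y * (c : G ⧸ V'') ^ j)
  (hidx' : ∀ x : M, (V'.subgroupOf (V ⊓ U')).index • x = 0) (hidx'' : ∀ x : M, (V''.subgroupOf (V ⊓ U'')).index • x = 0)

/-- (c4) **`d_{(U',V')} (H¹(Σ_{U''→U'}) x) = d_{(U'',V'')} x`** — naturality of `δ₁` for the level-change morphism of kernel sequences (brick (δ-b1)) followed by the transitivity of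
the wrong-way maps in the source (brick (δ-b2)). [cite: NeukirchSchmidtWingberg2008, (1.3.3), I §5 Prop. (1.5.3)] -/
theorem dPerm_coindFinSum (x : continuousCohomology 1 (coindFin.{0, u} ρ.toTopRep U'')) :
    dPerm ρ h' hVV c hU' hV' hc' hgen' hidx' (cohomologyMap (coindFinSum ρ.toTopRep hUU') 1 x) = dPerm ρ h'' (hVV'.trans hVV) c hU'' hV'' hc'' hgen'' hidx'' x := by
  rw [dPerm_apply, dPerm_apply]
  have hnat := IsSES.cohomologyMap_δ₁ (φ₁ := kerMapSum ρ h' h'' hVV' hUU' hV' hV'') (φ₂ := coindFinSum ρ.toTopRep hVV')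
    (φ₃ := coindFinSum ρ.toTopRep hUU') (isSES_kerIncl_coindFinSum ρ h'' hV'' hU'') (isSES_kerIncl_coindFinSum ρ h' hV' hU')
    (fun _ => rfl) (fun y => by
      change (coindFinSum ρ.toTopRep hUU').hom ((coindFinSum ρ.toTopRep h'').hom y) = (coindFinSum ρ.toTopRep h').hom ((coindFinSum ρ.toTopRep hVV').hom y)
      rw [coindFinSum_coindFinSum, coindFinSum_coindFinSum]) x
  exact (congrArg (cohomologyMap (rHom ρ h' hVV c hV' hc' hgen' hidx') 2) hnat.symm).trans
    (cohomologyMap_comp_apply_of_eq _ _ _ (rHom_kerMapSum ρ h'' h' hVV' hUU' hVV c hV'' hV' hc' hc'' hgen' hgen'' hidx' hidx'') 2 _)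

end Source

section Coeff

variable {M' : Type u} [AddCommGroup M'] [TopologicalSpace M'] [DiscreteTopology M'] (ρ' : ContinuousRep G ℤ M') (f : ρ.toTopRep ⟶ ρ'.toTopRep)
  {U' V' V : Subgroup G} (h' : V' ≤ U') (hVV : V' ≤ V) [V'.Normal] (c : G) [Fintype (G ⧸ V')]
  (hU' : IsOpen (U' : Set G)) (hV' : IsOpen (V' : Set G)) [Fintype (G ⧸ U')] [Finite M] [Finite M'] [Fintype (G ⧸ (V ⊓ U'))] (hc : c ∈ U')
  (hgen : ∀ y y' : G ⧸ V', Subgroup.quotientMapOfLE h' y = Subgroup.quotientMapOfLE h' y' → ∃ j : ℕ, y' = y * (c : G ⧸ V') ^ j)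
  (hidx : ∀ x : M, (V'.subgroupOf (V ⊓ U')).index • x = 0) (hidx' : ∀ x : M', (V'.subgroupOf (V ⊓ U')).index • x = 0)

/-- (c5) **Coefficient change**: `H²(Maps(G ⧸ V, f)) (d x) = d' (H¹(Maps(G ⧸ U', f)) x)`. [cite: NeukirchSchmidtWingberg2008, (1.3.3)] [cite: SerreLocalFields1979, VII §6] -/
theorem coindFinMap_dPerm (x : continuousCohomology 1 (coindFin.{0, u} ρ.toTopRep U')) :
    cohomologyMap (coindFinMap f V) 2 (dPerm ρ h' hVV c hU' hV' hc hgen hidx x) =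
      dPerm ρ' h' hVV c hU' hV' hc hgen hidx' (cohomologyMap (coindFinMap f U') 1 x) := by
  rw [dPerm_apply, dPerm_apply]
  have hnat := IsSES.cohomologyMap_δ₁ (φ₁ := kerMapCoeff ρ ρ' f h' hV') (φ₂ := coindFinMap f V') (φ₃ := coindFinMap f U')
    (isSES_kerIncl_coindFinSum ρ h' hV' hU') (isSES_kerIncl_coindFinSum ρ' h' hV' hU') (fun _ => rfl)
    (fun y => coindFinMap_coindFinSum f h' y) x
  refine Eq.trans ?_ (congrArg (cohomologyMap (rHom ρ' h' hVV c hV' hc hgen hidx') 2) hnat)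
  rw [cohomologyMap_comp_apply_of_eq _ _ (kerMapCoeff ρ ρ' f h' hV' ≫ rHom ρ' h' hVV c hV' hc hgen hidx')
      (fun ψ => (rHom_kerMapCoeff ρ ρ' f h' hVV c hV' hc hgen hidx hidx' ψ).symm) 2,
    cohomologyMap_comp_apply_of_eq _ _ (kerMapCoeff ρ ρ' f h' hV' ≫ rHom ρ' h' hVV c hV' hc hgen hidx') (fun _ => rfl) 2]

end Coeff

section Conj

variable {U' V' V : Subgroup G} (h' : V' ≤ U') (hVV : V' ≤ V) [U'.Normal] [V'.Normal] [V.Normal] (c : G) [Fintype (G ⧸ V')]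
  (hU' : IsOpen (U' : Set G)) (hV' : IsOpen (V' : Set G)) [Fintype (G ⧸ U')] [Finite M] [Fintype (G ⧸ (V ⊓ U'))] (hc : c ∈ U')
  (hgen : ∀ y y' : G ⧸ V', Subgroup.quotientMapOfLE h' y = Subgroup.quotientMapOfLE h' y' → ∃ j : ℕ, y' = y * (c : G ⧸ V') ^ j)
  (hidx : ∀ x : M, (V'.subgroupOf (V ⊓ U')).index • x = 0)

/-- (c6) **`H²(R_γ) (d x) = d (H¹(R_γ) x)` whenever `γ̄ c̄ = c̄ γ̄` in `G ⧸ V'`** — under Shapiro: `d` commutes with the conjugation action of every such `γ`.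
[cite: SerreLocalFields1979, VII §5] [cite: NeukirchSchmidtWingberg2008, (1.3.3), I §6 Prop. (1.6.5)] -/
theorem rTransHom_dPerm_conj (γ : G) (hcomm : (γ : G ⧸ V') * (c : G ⧸ V') = (c : G ⧸ V') * (γ : G ⧸ V'))
    (x : continuousCohomology 1 (coindFin.{0, u} ρ.toTopRep U')) :
    cohomologyMap (rTransHom ρ.toTopRep V (γ : G ⧸ V)) 2 (dPerm ρ h' hVV c hU' hV' hc hgen hidx x) =
      dPerm ρ h' hVV c hU' hV' hc hgen hidx (cohomologyMap (rTransHom ρ.toTopRep U' (γ : G ⧸ U')) 1 x) := by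
  rw [dPerm_apply, dPerm_apply]
  have hnat := IsSES.cohomologyMap_δ₁ (φ₁ := kerMapRTrans ρ h' hV' γ) (φ₂ := rTransHom ρ.toTopRep V' (γ : G ⧸ V'))
    (φ₃ := rTransHom ρ.toTopRep U' (γ : G ⧸ U')) (isSES_kerIncl_coindFinSum ρ h' hV' hU') (isSES_kerIncl_coindFinSum ρ h' hV' hU')
    (fun _ => rfl) (fun y => (coindFinSum_rTransHom ρ.toTopRep h' γ y).symm) x
  refine Eq.trans ?_ (congrArg (cohomologyMap (rHom ρ h' hVV c hV' hc hgen hidx) 2) hnat)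
  rw [cohomologyMap_comp_apply_of_eq _ _ (kerMapRTrans ρ h' hV' γ ≫ rHom ρ h' hVV c hV' hc hgen hidx)
      (fun ψ => (rHom_kerMapRTrans ρ h' hVV c hV' hc hgen hidx γ hcomm ψ).symm) 2,
    cohomologyMap_comp_apply_of_eq _ _ (kerMapRTrans ρ h' hV' γ ≫ rHom ρ h' hVV c hV' hc hgen hidx) (fun _ => rfl) 2]

end Conj

/-! ## §4 Exactness transfer down the tower -/

section Exact

variable {Um Vm Un Vn : Subgroup G}

omit [LocallyCompactSpace G] in
/-- The level-change map `ker Σ_m → ker Σ_n` factors as `(R_c − 1)' ∘ r` (pointwise: `(R_c − 1) (r ψ) = Σ_{V_m→V_n} ψ`, brick (δ-b2)). [cite: PerrinRiou1994Invent, §1.3] -/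
theorem kerMapSum_eq_rTransSubToKer_rHom (hm : Vm ≤ Um) (hn : Vn ≤ Un) (hVV : Vm ≤ Vn) (hUU : Um ≤ Un) [Vm.Normal] [Vn.Normal] (c : G)
    [Fintype (G ⧸ Vm)] [Fintype (G ⧸ Vn)] (hVm : IsOpen (Vm : Set G)) (hVn : IsOpen (Vn : Set G)) [Finite M] [Fintype (G ⧸ (Vn ⊓ Um))]
    (hcm : c ∈ Um) (hcn : c ∈ Un)
    (hgen : ∀ y y' : G ⧸ Vm, Subgroup.quotientMapOfLE hm y = Subgroup.quotientMapOfLE hm y' → ∃ j : ℕ, y' = y * (c : G ⧸ Vm) ^ j)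
    (hidx : ∀ x : M, (Vm.subgroupOf (Vn ⊓ Um)).index • x = 0) (ψ : sumKer ρ hm) :
    (kerMapSum ρ hn hm hVV hUU hVn hVm).hom ψ = (rTransSubToKer ρ hn hVn c hcn).hom ((rHom ρ hm hVV c hVm hcm hgen hidx).hom ψ) :=
  Subtype.ext (by
    rw [kerMapSum_apply_coe, rTransSubToKer_apply_coe, rTransSub_apply, rTransHom_rHom_sub])

/-- (c7) ★★ **EXACTNESS TRANSFER**: if `d_{(U_m,V_m)→V_n} x = 0` then `H¹(Σ_{U_m→U_n}) x` lies in the image of `H¹(Σ_{V_n→U_n})` — the finite-level form of «`ker δ ⊆ range sp`»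
(`δ_n (H¹(Σ^U) x) = H²(ker-map) (δ_m x) = H²((R_c − 1)') (H²(r) (δ_m x)) = 0`, then exactness at `H¹(Maps(G ⧸ U_n, M))`).
[cite: SerreGaloisCohomology1997, I §2.2–§2.3] [cite: NeukirchSchmidtWingberg2008, (1.3.2)–(1.3.3)] [cite: PerrinRiou1994Invent, §1.3] -/
theorem exists_coindFinSum_eq_of_dPerm_eq_zero (hm : Vm ≤ Um) (hn : Vn ≤ Un) (hVV : Vm ≤ Vn) (hUU : Um ≤ Un) [Vm.Normal] [Vn.Normal] (c : G)
    [Fintype (G ⧸ Vm)] [Fintype (G ⧸ Vn)] (hUm : IsOpen (Um : Set G)) (hVm : IsOpen (Vm : Set G)) (hUn : IsOpen (Un : Set G)) (hVn : IsOpen (Vn : Set G))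
    [Fintype (G ⧸ Um)] [Fintype (G ⧸ Un)] [Finite M] [Fintype (G ⧸ (Vn ⊓ Um))] (hcm : c ∈ Um) (hcn : c ∈ Un)
    (hgen : ∀ y y' : G ⧸ Vm, Subgroup.quotientMapOfLE hm y = Subgroup.quotientMapOfLE hm y' → ∃ j : ℕ, y' = y * (c : G ⧸ Vm) ^ j)
    (hidx : ∀ x : M, (Vm.subgroupOf (Vn ⊓ Um)).index • x = 0) (x : continuousCohomology 1 (coindFin.{0, u} ρ.toTopRep Um))
    (hx : dPerm ρ hm hVV c hUm hVm hcm hgen hidx x = 0) :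
    ∃ w : continuousCohomology 1 (coindFin.{0, u} ρ.toTopRep Vn),
      cohomologyMap (coindFinSum ρ.toTopRep hn) 1 w = cohomologyMap (coindFinSum ρ.toTopRep hUU) 1 x := by
  have hnat := IsSES.cohomologyMap_δ₁ (φ₁ := kerMapSum ρ hn hm hVV hUU hVn hVm) (φ₂ := coindFinSum ρ.toTopRep hVV)
    (φ₃ := coindFinSum ρ.toTopRep hUU) (isSES_kerIncl_coindFinSum ρ hm hVm hUm) (isSES_kerIncl_coindFinSum ρ hn hVn hUn)
    (fun _ => rfl) (fun y => by
      change (coindFinSum ρ.toTopRep hUU).hom ((coindFinSum ρ.toTopRep hm).hom y) = (coindFinSum ρ.toTopRep hn).hom ((coindFinSum ρ.toTopRep hVV).hom y)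
      rw [coindFinSum_coindFinSum, coindFinSum_coindFinSum]) x
  have hfac := cohomologyMap_comp_apply_of_eq (rHom ρ hm hVV c hVm hcm hgen hidx) (rTransSubToKer ρ hn hVn c hcn) (kerMapSum ρ hn hm hVV hUU hVn hVm)
    (fun ψ => (kerMapSum_eq_rTransSubToKer_rHom ρ hm hn hVV hUU c hVm hVn hcm hcn hgen hidx ψ).symm) 2
    ((isSES_kerIncl_coindFinSum ρ hm hVm hUm).δ₁ x)
  have hx' : cohomologyMap (rHom ρ hm hVV c hVm hcm hgen hidx) 2 ((isSES_kerIncl_coindFinSum ρ hm hVm hUm).δ₁ x) = 0 := hx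
  have hzero : (isSES_kerIncl_coindFinSum ρ hn hVn hUn).δ₁ (cohomologyMap (coindFinSum ρ.toTopRep hUU) 1 x) = 0 := by
    refine hnat.symm.trans (hfac.symm.trans ?_)
    rw [hx', map_zero]
  exact (isSES_kerIncl_coindFinSum ρ hn hVn hUn).exists_map_one_eq_of_δ₁_eq_zero _ hzero

end Exact

end Summit.BirchSwinnertonDyer.BirchSwinnertonDyer.Theorems.SmallImageRttD2J2Delta

end
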